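/-
Copyright (c) 2026. Released under Apache 2.0 license.
-/
import Summits.RiemannHypothesis.RiemannHypothesis.Theorems.SemilocalCert552Check
import Summits.RiemannHypothesis.RiemannHypothesis.Theorems.SemilocalThresholdCertificateBridge
import Summits.RiemannHypothesis.RiemannHypothesis.Theorems.MotivicDoorSemilocalUndecicBound
import HarnessLib

/-!
# Semi-local threshold `a*({2})`: the lower rung `69/125 = 0.552 ≤ a*({2})` (was `563/1024 = 0.5498`)

Cell `rh-explicit`, seat cc-s2-2, block C⁺/B1.  The kernel-checked one-prime Stage-C certificate `weilCert3S552`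
(`weilCert3S552.check = true`, `SemilocalCert552Check.lean`; window `b = 69/125 ≤ 6931471/10⁷ ≤ log 2`) through the
generic bridge (B+) of `SemilocalThresholdCertificateBridge.lean`
(`weilSemilocalPositivityOn_two_of_check_of_le`, `le_weilSemilocalThreshold`):
`{∞,2}`-positivity of the semi-local Weil form on `C(69/125)`, hence `69/125 ≤ a*({2})`
(`weilSemilocalThreshold {2}`, `MotivicDoorSemilocalThreshold.lean`), and the same for every finite `S ∋ 2`,
`3 ∉ S`.  With the tree's undecic upper rung this reads `a*({2}) ∈ [0.552, 0.57]`
(`MotivicDoorSemilocalUndecicBound.lean`); DATA `a*({2}) = 0.55729 ± 10⁻⁵` (cell rh-explicit, cc-s2-3).  Honest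
framing: theorems about the TREE's object `weilSemilocalThreshold`; no statement about `ζ`, no RH claim.
-/

set_option linter.dupNamespace false  -- the mandated namespace repeats `RiemannHypothesis`

noncomputable section

open Set Real
open Literature.NumberTheory.LFunctions
open Summit.RiemannHypothesis.RiemannHypothesis.Theorems.MotivicDoor.SemilocalThreshold
open Summit.RiemannHypothesis.RiemannHypothesis.Theorems.MotivicDoor.Semilocal
open Summit.RiemannHypothesis.RiemannHypothesis.Theorems.SemilocalCertificateBridge

namespace Summit.RiemannHypothesis.RiemannHypothesis.Theorems.SemilocalCert552

/-- The window of `weilCert3S552` is `69/125`. [folklore] -/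
theorem certb_cert552 : weilCert3S552.b = 69 / 125 := rfl

/-- The window passes the decidable `log 2` test of the bridge: `69/125 ≤ 6931471/10⁷`. [folklore] -/
theorem certb_cert552_le : weilCert3S552.b ≤ 6931471 / 10000000 := by
  rw [certb_cert552]; norm_num

/-- **`{∞,2}`-positivity on `C(69/125)`**: the semi-local Weil form of `S = {2}` is non-negative on every test
function supported in `[-0.552, 0.552]` (kernel-checked Stage-C certificate + bridge (B+)). [folklore] -/
theorem weilSemilocalPositivityOn_two_552 : WeilSemilocalPositivityOn {2} ((69 : ℝ) / 125) := by
  have h := weilSemilocalPositivityOn_two_of_check_of_le check_cert552 certb_cert552_le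
  rw [certb_cert552] at h
  convert h using 2
  push_cast
  ring

/-- **Lower rung of CC-M2: `69/125 = 0.552 ≤ a*({2})`.** [folklore] -/
theorem le_weilSemilocalThreshold_two_552 : (69 : ℝ) / 125 ≤ weilSemilocalThreshold {2} :=
  le_weilSemilocalThreshold weilSemilocalPositivityOn_two_552

/-- The two-sided location with the tree's undecic upper rung: `a*({2}) ∈ [69/125, 57/100]`. [folklore] -/
theorem weilSemilocalThreshold_two_mem_Icc_552_57 :
    weilSemilocalThreshold {2} ∈ Icc ((69 : ℝ) / 125) (57 / 100) :=
  ⟨le_weilSemilocalThreshold_two_552,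
    Summit.RiemannHypothesis.RiemannHypothesis.Theorems.MotivicDoor.SemilocalUndecic.weilSemilocalThreshold_two_le⟩

/-- Transport to every finite set of places `S ∋ 2` with `3 ∉ S`: `0.552 ≤ a*(S)`. [folklore] -/
theorem le_weilSemilocalThreshold_552 {S : Finset ℕ} (h2 : 2 ∈ S) (h3 : 3 ∉ S) :
    (69 : ℝ) / 125 ≤ weilSemilocalThreshold S := by
  rw [weilSemilocalThreshold_eq_two h2 h3]
  exact le_weilSemilocalThreshold_two_552

end Summit.RiemannHypothesis.RiemannHypothesis.Theorems.SemilocalCert552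

end
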